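import Summits.BirchSwinnertonDyer.Rank1Residual.X11a.PrintDischargeMuTable
import Summits.BirchSwinnertonDyer.Rank1Residual.X11a.PrintDischargeMuAnRecords
import Literature.NumberTheory.EllipticCurves.Rank1Residual.X11aPrintCertificates.ClaimMuTableRiemannSum
import Literature.NumberTheory.EllipticCurves.Wuthrich2014.ShaBoundProofs
import Literature.NumberTheory.EllipticCurves.LeadingTermPPartProofs
import Literature.NumberTheory.EllipticCurves.PAdicGrossZagierConstantTermProofs
import HarnessLib

/-!
# Class X11a — the PRINT route's discharge interface, part 8b: the TABLE RECORD doors — a certified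
# μ symbol table (`MuTable`, kernel-checked) and its claim give the μ-claim and the Euler half at a
# non-surjective X11a pair, the unit Riemann sum being EVALUATED BY THE KERNEL

Cell `bsd-print-x11a` (D-0131 print tier), seat ty2 (the DISCHARGE INTERFACE). THEOREMS ONLY (no
definition, no named fact, no `sorry`). Sequel of part 8 (`PrintDischargeMuTable.lean`: the μ-claim
`X11a.MuAnZeroAt W p` DERIVED from a symbol table `x = u·ϖ₀·[·]⁺_{f₀}` with `‖x 0‖_p ≤ 1` and ONE unit
Riemann sum `‖RS k n₀‖_p = 1` — there DISPLAYED hypotheses) and of ty3's `ClaimMuTable.lean` /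
`RecordsLeafNonSurjMuTablesPart1–2.lean` / `RecordsThreeNonSurjMuTables.lean` (37 kernel-checked μ symbol
tables). The Literature companion `X11aPrintCertificates/ClaimMuTableRiemannSum.lean` (this seat) proves
the TEICHMÜLLER-COSET EVALUATION: for odd `p` the abstract Riemann sum over `μ_{p−1}(ℤ_p) × ℤ/p^{n₀}` of
part 8 IS the exact rational `t.riemannSum k` read off the displayed table, and its kernel check
`MuTable.checkRiemannSum` (`p ∤ num`, `p ∤ den` of `RS_lam`) gives `‖RS_lam‖_p = 1`. THIS FILE composes:

* §1 the `p`-INTEGRALITY OF THE CENTRAL VALUE `ϖ₀·[0]⁺_{f₀} = L(E,1)/Ω_E` (the `‖x 0‖_p ≤ 1` of part 8):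
  from a displayed rational `ℓ` with `L(E,1) = ℓ·Ω_E`, `‖ℓ‖_p ≤ 1`, and FOR A CERTIFICATE RECORD from
  its claim — `#Ш_an = shaAn ∈ ℕ`, `#E(ℚ)_tors = torsion` with `p ∤ torsion` (kernel), `∏c_q = tamagawa`
  — and Gross–Zagier–Kolyvagin (`shaAn_eq_of_L_one_div_eq`: `#Ш_an = (L/Ω)·#E(ℚ)²/∏c` at `L(E,1) ≠ 0`,
  so `L/Ω = shaAn·tamagawa/torsion²`; `[0]⁺ = 0` at `L(E,1) = 0`);
* §2 the TABLE DOORS ON THE CLASS: **`ClassX11a.muAnZeroAt_of_muTable`** — `ClassX11a W p`, Mazur's fact,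
  the integrality of `ϖ₀·[0]⁺_{f₀}`, a table `t` at `p` with `t.checkRiemannSum = true` (KERNEL), the bit
  `split at p → t.split = true` and the claim `t.ClaimFor W` ⟹ `X11a.MuAnZeroAt W p` (part 8's
  `ClassX11a.muAnZeroAt_of_symbolTable` with `x := u·ϖ₀·[·]⁺_{f₀}`, `n₀ := t.n − 1`, index `t.lam` /
  signed sums at a non-split `p`, `(t.lam − 1) + 1` / unsigned sums at a split `p`, `hunit` by the
  evaluation), and the crux-U compositions `ClassX11a.missingUpperBoundAt_of_muTable_of_not_surj[_of_nonsplit]`;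
* §3 the RECORD DOORS: for a certificate record `r` (`r.check`, `r.Claim`) and a μ symbol table `t` keyed
  to it, `t.checkRiemannSum = true` and `t.ClaimFor r.curve` ⟹ `X11a.MuAnZeroAt r.curve r.p`
  (`X11a.muAnZeroAt_of_record_muTable`; split bit and central value from the record's claim), and
  **`X11a.missingUpperBoundAt_of_record_muTable[_of_nonsplit]`**, `X11a.bsdp_of_record_muTable` —
  part 7's doors with the ASSUMED dictionary `Record.MuClaim` replaced by the value identification.

Displayed per pair after this part: the ten facts [+ Greenberg–Stevens at a split pair], Mazur's fact,
Gross–Zagier–Kolyvagin, `r.check` / `t.checkRiemannSum` (kernel), `r.Claim`, `t.keyOf r`, the image bit,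
and `t.ClaimFor r.curve` — ONE newform `f₀`, `ϖ₀`, a `p`-unit `u` and `u·ϖ₀·[a/pⁿ]⁺_{f₀}` = the displayed
value at each entry (the two-engine datum S ≡ P). HONEST FRAMING: per pair (E1 currency); `ClaimFor` is an
engine claim, not a kernel fact; nothing here proves `μ = 0` class-wide (Greenberg's conjecture on the
non-surjective locus, barrier B3, stays open); the leaf `ClassX11a` stays open. beyond-print theorem: no.

References: [MazurTateTeitelbaum1986Invent] §I.8, §I.10 Prop., §I.12–I.14; [SteinWuthrich2013] §3, §4.2;
[Washington1997] §5.1, §7.2; [Mazur1978] Cor. 4.1; [Miller2011LMS] §1, Def. 1.1; [Wuthrich2014] Cor. 18,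
Prop. 21; [Kato2004Asterisque] §17.13; [GreenbergStevens1993] Thm. (0.3); cell files
`pub/bsd-print-x11a/TY2-DISCHARGE-INTERFACE.md` §J–§L, `TY3-CERTIFICATE-RECORDS.md`, `DOSSIER.md` §26, §33, §36.
-/

set_option autoImplicit false

noncomputable section

open scoped Classical MatrixGroups ModularForm

open CongruenceSubgroup WeierstrassCurve Literature.NumberTheory.EllipticCurves
  Literature.NumberTheory.EllipticCurves.ModularForms
  Literature.NumberTheory.EllipticCurves.Rank1Residual
  Literature.NumberTheory.EllipticCurves.Rank1Residual.Typed
  Literature.NumberTheory.EllipticCurves.Rank1Residual.X11aPrintCertificates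
  Literature.NumberTheory.EllipticCurves.Wuthrich2014
  Literature.NumberTheory.EllipticCurves.SteinWuthrich2013
  Literature.NumberTheory.EllipticCurves.Greenberg1999
  Literature.NumberTheory.EllipticCurves.Kato2004

namespace Summit.BirchSwinnertonDyer.Rank1Residual.X11a

/-! ### §1 The `p`-integrality of the central value `ϖ₀·[0]⁺_{f₀} = L(E,1)/Ω_E` -/

section CentralValue

variable {W : WeierstrassCurve ℚ} [W.IsElliptic] {p : ℕ} [Fact p.Prime]

/-- **`‖ϖ₀·[0]⁺_{f₀}‖_p ≤ 1` from a displayed `p`-integral `L(E,1)/Ω_E`.** For the newform `f₀` of `W`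
and `ϖ₀·Ω_E = Ω⁺_{f₀}`: `L(E,1) = [0]⁺_{f₀}·Ω⁺_{f₀}` (`IsNewformOf.entireLFunction_one_eq`, MTT §I.8 (8.6))
`= ϖ₀[0]⁺_{f₀}·Ω_E`, so `L(E,1) = ℓ·Ω_E` forces `ϖ₀·[0]⁺_{f₀} = ℓ`.
[cite: MazurTateTeitelbaum1986Invent, §I.8 (8.6)] -/
theorem norm_periodRatio_mul_ratPlusSymbol_zero_le_one_of_lRatio
    {N₀ : ℕ} [NeZero N₀] {f₀ : CuspForm (Gamma0 N₀) 2} (hf₀ : IsNewformOf W f₀)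
    {ϖ₀ : ℚ} (hϖ₀ : (ϖ₀ : ℝ) * W.realPeriodRat = plusPeriod f₀)
    (ℓ : ℚ) (hℓ : W.entireLFunction 1 = (ℓ : ℂ) * (W.realPeriodRat : ℂ))
    (hℓ1 : ‖((ℓ : ℚ) : ℚ_[p])‖ ≤ 1) :
    ‖((ϖ₀ * ratPlusSymbol f₀ 0 : ℚ) : ℚ_[p])‖ ≤ 1 := by
  have hΩ : (W.realPeriodRat : ℝ) ≠ 0 := W.realPeriodRat_pos_holds.ne'
  have hre : ((ratPlusSymbol f₀ 0 : ℚ) : ℝ) * plusPeriod f₀ = (ℓ : ℝ) * W.realPeriodRat := by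
    have h := hf₀.entireLFunction_one_eq
    rw [hℓ] at h
    exact_mod_cast h.symm
  rw [← hϖ₀, ← mul_assoc, mul_left_inj' hΩ] at hre
  have hq : ϖ₀ * ratPlusSymbol f₀ 0 = ℓ := by
    have h' : ((ϖ₀ * ratPlusSymbol f₀ 0 : ℚ) : ℝ) = (ℓ : ℝ) := by push_cast; linarith [hre]
    exact_mod_cast h'
  rw [hq]
  exact hℓ1

end CentralValue

section RecordCentralValue

variable (r : Record) [Fact r.p.Prime] [r.curve.IsElliptic] [r.curve.IsGloballyMinimal]

/-- **`‖ϖ₀·[0]⁺_{f₀}‖_p ≤ 1` FOR A CERTIFICATE RECORD, from its claim and Gross–Zagier–Kolyvagin.**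
If `L(E,1) = 0` then `[0]⁺_{f₀} = 0`; otherwise `L(E,1)/Ω_E = ϖ₀·[0]⁺_{f₀}` is rational, so
`#Ш_an = (L/Ω)·#E(ℚ)²/∏c` (`shaAn_eq_of_L_one_div_eq`: rank `0`, `E(ℚ)` finite, `Reg = 1` by `hGZK`),
and the claim's `#Ш_an = r.shaAn ∈ ℕ`, `#E(ℚ)_tors = r.torsion`, `∏c = r.tamagawa` with the kernel's
`p ∤ r.torsion` (`Record.shaAn_pos_of_check`) give `ϖ₀[0]⁺ = shaAn·tamagawa/torsion²`, `p`-integral.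
[cite: Miller2011LMS, §1 (arXiv:1010.2431 p. 3)] [cite: MazurTateTeitelbaum1986Invent, §I.8 (8.6)] -/
theorem _root_.Literature.NumberTheory.EllipticCurves.Rank1Residual.X11aPrintCertificates.Record.norm_periodRatio_mul_ratPlusSymbol_zero_le_one_of_claim
    (hGZK : rank_eq_analyticRank_of_analyticRank_le_one) (hc : r.check = true) (h : r.Claim)
    {N₀ : ℕ} [NeZero N₀] {f₀ : CuspForm (Gamma0 N₀) 2} (hf₀ : IsNewformOf r.curve f₀)
    {ϖ₀ : ℚ} (hϖ₀ : (ϖ₀ : ℝ) * r.curve.realPeriodRat = plusPeriod f₀) :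
    ‖((ϖ₀ * ratPlusSymbol f₀ 0 : ℚ) : ℚ_[r.p])‖ ≤ 1 := by
  by_cases hL : r.curve.entireLFunction 1 = 0
  · rw [ratPlusSymbol_zero_eq_zero_of_entireLFunction_eq_zero hf₀ hL, mul_zero, Rat.cast_zero,
      norm_zero]
    exact zero_le_one
  obtain ⟨-, -, -, -, -, -, -, hsha, htor, htam⟩ := h
  set q : ℚ := ϖ₀ * ratPlusSymbol f₀ 0 with hq_def
  have hΩ : (r.curve.realPeriodRat : ℝ) ≠ 0 := r.curve.realPeriodRat_pos_holds.ne'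
  have hq : r.curve.entireLFunction 1 / (r.curve.realPeriodRat : ℂ) = (q : ℂ) := by
    have hΩ' : (r.curve.realPeriodRat : ℂ) ≠ 0 := by exact_mod_cast hΩ
    rw [div_eq_iff hΩ', hf₀.entireLFunction_one_eq, ← hϖ₀, hq_def]
    push_cast
    ring
  obtain ⟨-, hfin, -, hshaAn⟩ := shaAn_eq_of_L_one_div_eq hGZK r.curve hL hq
  haveI := hfin
  have hcard : Nat.card r.curve.toAffine.Point = r.torsion := by
    rw [← r.curve.torsionOrder_eq_natCard_of_finite, htor]
  rw [hcard, htam, hsha] at hshaAn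
  have hid : (r.shaAn : ℚ) = q * (r.torsion : ℚ) ^ 2 / (r.tamagawa : ℚ) := by exact_mod_cast hshaAn
  have htors0 : (r.torsion : ℚ) ≠ 0 := by
    have hnd := (r.shaAn_pos_of_check hc).2
    exact_mod_cast (show r.torsion ≠ 0 from fun h0 ↦ hnd (h0 ▸ dvd_zero _))
  have htam0 : (r.tamagawa : ℚ) ≠ 0 := by
    have htp : 0 < r.curve.tamagawaProduct := r.curve.tamagawaProduct_pos_holds
    rw [htam] at htp
    exact_mod_cast htp.ne'
  have hq' : q = (r.shaAn : ℚ) * (r.tamagawa : ℚ) / (r.torsion : ℚ) ^ 2 := by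
    rw [hid]
    field_simp
  have hnt : ‖((r.torsion : ℚ) : ℚ_[r.p])‖ = 1 := by
    rw [Rat.cast_natCast, ← Int.cast_natCast]
    refine le_antisymm (Padic.norm_int_le_one _) (not_lt.mp fun hlt ↦ (r.shaAn_pos_of_check hc).2 ?_)
    exact Int.natCast_dvd_natCast.mp (Padic.norm_intCast_lt_one_iff.mp hlt)
  have hns : ‖((r.shaAn : ℚ) : ℚ_[r.p])‖ ≤ 1 := by
    rw [Rat.cast_natCast, ← Int.cast_natCast]; exact Padic.norm_int_le_one _
  have hnc : ‖((r.tamagawa : ℚ) : ℚ_[r.p])‖ ≤ 1 := by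
    rw [Rat.cast_natCast, ← Int.cast_natCast]; exact Padic.norm_int_le_one _
  rw [hq', Rat.cast_div, Rat.cast_mul, Rat.cast_pow, norm_div, norm_mul, norm_pow, hnt, one_pow, div_one]
  calc ‖((r.shaAn : ℚ) : ℚ_[r.p])‖ * ‖((r.tamagawa : ℚ) : ℚ_[r.p])‖ ≤ 1 * 1 :=
        mul_le_mul hns hnc (norm_nonneg _) zero_le_one
    _ = 1 := one_mul 1

end RecordCentralValue

/-! ### §2 The table doors on the class -/

section ClassDoors

variable {W : WeierstrassCurve ℚ} [W.IsElliptic] [W.IsGloballyMinimal] {p : ℕ} [Fact p.Prime]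

/-- **TABLE ⇒ μ-CLAIM on the class, the unit Riemann sum evaluated by the kernel.** For `W` globally
minimal in class X11a at `p`, Mazur's fact (‖ϖ₀‖_p = 1), the `p`-integrality of the central value
`ϖ₀·[0]⁺_{f₀}` (for every newform/period ratio; §1), and a μ symbol table `t` at `p` with
`t.checkRiemannSum = true` (KERNEL: level `n ≥ 1`, Teichmüller cosets complete, `lam < p^{n−1}`,
`lam ≥ 1` if filed split, `p ∤ num, den` of the exact `RS_lam`), the consistency bit
`split at p → t.split = true`, and the table's CLAIM `t.ClaimFor W` (`f₀, ϖ₀, u` and `u·ϖ₀·[a/pⁿ]⁺_{f₀}`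
= the displayed values): `X11a.MuAnZeroAt W p`. Part 8's `ClassX11a.muAnZeroAt_of_symbolTable` with
`x := u·ϖ₀·[·]⁺_{f₀}`, the all-levels bound from Manin + Mazur, and `‖RS‖ = 1` by the Teichmüller-coset
evaluation `MuTable.finsum_riemann_eq_cast_riemannSum[_signed]` (index `lam`, signed sums, at a non-split
`p`; `(lam − 1) + 1`, unsigned sums, at a split `p`). PER PAIR (E1 currency).
[cite: MazurTateTeitelbaum1986Invent, §I.10 Prop., §I.12–I.14] [cite: Mazur1978, Cor. 4.1]
[cite: Washington1997, §5.1 and §7.2] [cite: SteinWuthrich2013, §3 and §4.2] -/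
theorem _root_.Summit.BirchSwinnertonDyer.Rank1Residual.ClassX11a.muAnZeroAt_of_muTable
    (hM : mazur_not_dvd_maninConstant_of_odd) (hX : ClassX11a W p)
    (hint : ∀ {N₀ : ℕ} [NeZero N₀] (f₀ : CuspForm (Gamma0 N₀) 2) (ϖ₀ : ℚ), IsNewformOf W f₀ →
      (ϖ₀ : ℝ) * W.realPeriodRat = plusPeriod f₀ → ‖((ϖ₀ * ratPlusSymbol f₀ 0 : ℚ) : ℚ_[p])‖ ≤ 1)
    (t : MuTable) (hp : t.p = p) (ht : t.checkRiemannSum = true)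
    (hts : W.HasSplitMultiplicativeReductionAtPrime p → t.split = true) (hT : t.ClaimFor W) :
    X11a.MuAnZeroAt W p := by
  obtain ⟨hn, hcomp, hk, hsl, hnum, hden⟩ := t.checkRiemannSum_spec ht
  subst hp
  obtain ⟨N₀, hN₀, f₀, ϖ₀, u, hf₀, hϖ₀, hu, hval⟩ := hT
  have hunit : ‖((t.riemannSum t.lam : ℚ) : ℚ_[t.p])‖ = 1 := norm_ratCast_eq_one_of_not_dvd hnum hden
  have hx0 : ‖((fun r : ℚ ↦ u * ϖ₀ * ratPlusSymbol f₀ r) 0 : ℚ_[t.p])‖ ≤ 1 := by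
    dsimp only
    rw [mul_assoc, Rat.cast_mul, norm_mul, hu, one_mul]
    exact hint f₀ ϖ₀ hf₀ hϖ₀
  have hxv : ∀ v ∈ t.values, (fun r : ℚ ↦ u * ϖ₀ * ratPlusSymbol f₀ r) ((v.1 : ℚ) / (t.p : ℚ) ^ t.n) =
      (v.2.1 : ℚ) / (v.2.2 : ℚ) := hval
  have hevu := t.finsum_riemann_eq_cast_riemannSum rfl hX.ne_two hn hcomp
    (x := fun r : ℚ ↦ u * ϖ₀ * ratPlusSymbol f₀ r) hxv t.lam
  have hevs := t.finsum_riemann_eq_cast_riemannSum_signed rfl hX.ne_two hn hcomp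
    (x := fun r : ℚ ↦ u * ϖ₀ * ratPlusSymbol f₀ r) hxv t.lam
  -- refresh the goal (the `NeZero N₀` hypothesis introduced by `obtain` from the claim's `∃` must
  -- enter the local-instance cache of the goals below)
  show X11a.MuAnZeroAt W t.p
  by_cases hsp' : W.HasSplitMultiplicativeReductionAtPrime t.p
  · have h1 : 1 ≤ t.lam := hsl (hts hsp')
    refine hX.muAnZeroAt_of_symbolTable hM hf₀ hϖ₀ hu (x := fun r ↦ u * ϖ₀ * ratPlusSymbol f₀ r)
      (fun _ ↦ rfl) hx0 (n := t.lam - 1) (fun h ↦ absurd hsp' h)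
      (fun _ ↦ ⟨t.n - 1, _, fun _ _ ↦ rfl, by omega, ?_⟩)
    beta_reduce
    rw [Nat.sub_add_cancel h1, hevu]
    exact hunit
  · refine hX.muAnZeroAt_of_symbolTable hM hf₀ hϖ₀ hu (x := fun r ↦ u * ϖ₀ * ratPlusSymbol f₀ r)
      (fun _ ↦ rfl) hx0 (n := t.lam) (fun _ ↦ ⟨t.n - 1, _, fun _ _ ↦ rfl, hk, ?_⟩)
      (fun h ↦ absurd h hsp')
    beta_reduce
    rw [hevs, norm_mul, norm_pow, norm_neg, norm_one, one_pow, one_mul]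
    exact hunit

/-- **TABLE ⇒ μ-claim on the class, with a DISPLAYED central value** `L(E,1) = ℓ·Ω_E`, `‖ℓ‖_p ≤ 1`
(the unit-value door's single rational) instead of §1's newform-quantified integrality.
[cite: MazurTateTeitelbaum1986Invent, §I.8 (8.6), §I.10 Prop., §I.12–I.14] [cite: Mazur1978, Cor. 4.1] -/
theorem _root_.Summit.BirchSwinnertonDyer.Rank1Residual.ClassX11a.muAnZeroAt_of_muTable_of_lRatio
    (hM : mazur_not_dvd_maninConstant_of_odd) (hX : ClassX11a W p)
    (ℓ : ℚ) (hℓ : W.entireLFunction 1 = (ℓ : ℂ) * (W.realPeriodRat : ℂ)) (hℓ1 : ‖((ℓ : ℚ) : ℚ_[p])‖ ≤ 1)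
    (t : MuTable) (hp : t.p = p) (ht : t.checkRiemannSum = true)
    (hts : W.HasSplitMultiplicativeReductionAtPrime p → t.split = true) (hT : t.ClaimFor W) :
    X11a.MuAnZeroAt W p :=
  hX.muAnZeroAt_of_muTable hM
    (fun _ _ hf₀ hϖ₀ ↦ norm_periodRatio_mul_ratPlusSymbol_zero_le_one_of_lRatio hf₀ hϖ₀ ℓ hℓ hℓ1)
    t hp ht hts hT

/-- **TABLE DOOR on the class (crux-U currency)**: at a non-surjective X11a pair, the ten facts
[+ Greenberg–Stevens], Mazur's fact, the central-value integrality, and a kernel-checked μ symbol table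
with its claim give `Typed.MissingUpperBoundAt W p` (part 6
`ClassX11a.missingUpperBoundAt_of_muAnZeroAt_of_not_surj` ∘ `muAnZeroAt_of_muTable`). PER PAIR.
[cite: MazurTateTeitelbaum1986Invent, §I.10 Prop., §I.12–I.14] [cite: Kato2004Asterisque, §17.13 (pp. 279–280)]
[cite: Wuthrich2014, Cor. 18 (p. 398)] [cite: GreenbergStevens1993, Thm. (0.3) (p. 407)] [cite: Miller2011LMS, Def. 1.1] -/
theorem _root_.Summit.BirchSwinnertonDyer.Rank1Residual.ClassX11a.missingUpperBoundAt_of_muTable_of_not_surj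
    (hJs : thm61_splitMultiplicative) (hJn : thm61_nonsplitMultiplicative)
    (hGZK : rank_eq_analyticRank_of_analyticRank_le_one) (hpar : nonempty_modularParametrizationData)
    (h12 : Kato2004.thm12_4)
    (hns : Kato2004.exists_multDivisibilityInputs_nonsplit)
    (hsp : Kato2004.exists_multDivisibilityInputs_split)
    (h15 : thm15_isTorsion_multiplicative_rat)
    (h18 : Wuthrich2014.corollary18_padicLFunction_mem_iwasawaAlgebra_multiplicative)
    (hfine : Kato2004.exists_multDivisibilityInputs_fine)
    (hGS : greenberg_stevens (W := W) (p := p))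
    (hM : mazur_not_dvd_maninConstant_of_odd) (hX : ClassX11a W p) (hnsj : ¬ Surj W p)
    (hint : ∀ {N₀ : ℕ} [NeZero N₀] (f₀ : CuspForm (Gamma0 N₀) 2) (ϖ₀ : ℚ), IsNewformOf W f₀ →
      (ϖ₀ : ℝ) * W.realPeriodRat = plusPeriod f₀ → ‖((ϖ₀ * ratPlusSymbol f₀ 0 : ℚ) : ℚ_[p])‖ ≤ 1)
    (t : MuTable) (hp : t.p = p) (ht : t.checkRiemannSum = true)
    (hts : W.HasSplitMultiplicativeReductionAtPrime p → t.split = true) (hT : t.ClaimFor W) :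
    MissingUpperBoundAt W p :=
  hX.missingUpperBoundAt_of_muAnZeroAt_of_not_surj hJs hJn hGZK hpar h12 hns hsp h15 h18 hfine hGS hnsj
    (hX.muAnZeroAt_of_muTable hM hint t hp ht hts hT)

/-- **TABLE DOOR on the class, NON-SPLIT regime — no Greenberg–Stevens binder, no split bit** (part 6
§1c `ClassX11a.missingUpperBoundAt_of_muAnZeroAt_of_not_surj_of_nonsplit` ∘ `muAnZeroAt_of_muTable`).
[cite: MazurTateTeitelbaum1986Invent, §I.10 Prop. (a_p = −1), §I.12–I.14] [cite: Kato2004Asterisque, §17.13 (pp. 279–280)]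
[cite: Wuthrich2014, Cor. 18 (p. 398)] [cite: Miller2011LMS, Def. 1.1] -/
theorem _root_.Summit.BirchSwinnertonDyer.Rank1Residual.ClassX11a.missingUpperBoundAt_of_muTable_of_not_surj_of_nonsplit
    (hJs : thm61_splitMultiplicative) (hJn : thm61_nonsplitMultiplicative)
    (hGZK : rank_eq_analyticRank_of_analyticRank_le_one) (hpar : nonempty_modularParametrizationData)
    (h12 : Kato2004.thm12_4)
    (hns : Kato2004.exists_multDivisibilityInputs_nonsplit)
    (hsp : Kato2004.exists_multDivisibilityInputs_split)
    (h15 : thm15_isTorsion_multiplicative_rat)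
    (h18 : Wuthrich2014.corollary18_padicLFunction_mem_iwasawaAlgebra_multiplicative)
    (hfine : Kato2004.exists_multDivisibilityInputs_fine)
    (hM : mazur_not_dvd_maninConstant_of_odd) (hX : ClassX11a W p) (hnsj : ¬ Surj W p)
    (hnsp : ¬ W.HasSplitMultiplicativeReductionAtPrime p)
    (hint : ∀ {N₀ : ℕ} [NeZero N₀] (f₀ : CuspForm (Gamma0 N₀) 2) (ϖ₀ : ℚ), IsNewformOf W f₀ →
      (ϖ₀ : ℝ) * W.realPeriodRat = plusPeriod f₀ → ‖((ϖ₀ * ratPlusSymbol f₀ 0 : ℚ) : ℚ_[p])‖ ≤ 1)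
    (t : MuTable) (hp : t.p = p) (ht : t.checkRiemannSum = true) (hT : t.ClaimFor W) :
    MissingUpperBoundAt W p :=
  hX.missingUpperBoundAt_of_muAnZeroAt_of_not_surj_of_nonsplit hJs hJn hGZK hpar h12 hns hsp h15 h18 hfine
    hnsj hnsp (hX.muAnZeroAt_of_muTable hM hint t hp ht (fun h ↦ absurd h hnsp) hT)

end ClassDoors

/-! ### §3 Record doors: a certificate record and a μ symbol table keyed to it -/

section Records

variable (r : Record) [Fact r.p.Prime] [r.curve.IsElliptic] [r.curve.IsGloballyMinimal]

omit [Fact r.p.Prime] [r.curve.IsElliptic] [r.curve.IsGloballyMinimal] in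
/-- A table keyed to a record has the record's prime and split bit. [folklore] -/
theorem p_eq_and_split_eq_of_keyOf (t : MuTable) (hkey : t.keyOf r = true) :
    t.p = r.p ∧ t.split = r.split := by
  unfold MuTable.keyOf at hkey
  simp only [Bool.and_eq_true, beq_iff_eq] at hkey
  exact ⟨hkey.1.1.1.1.2, hkey.1.2⟩

/-- The split bit of a table keyed to a record whose claim holds: split reduction at `p` forces
`t.split = true` (the claim's `r.split = false → ¬ split`). [folklore] -/
theorem split_eq_true_of_claim (t : MuTable) (h : r.Claim) (hsplit : t.split = r.split)
    (hs : r.curve.HasSplitMultiplicativeReductionAtPrime r.p) : t.split = true := by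
  obtain ⟨-, -, -, -, -, -, hnsp, -, -, -⟩ := h
  rw [hsplit]
  cases hb : r.split
  · exact absurd hs (hnsp hb)
  · rfl

/-- **A certificate record's μ-claim DERIVED from its μ symbol table**: `r.check`, `r.Claim`, a table `t`
keyed to `r` with `t.checkRiemannSum = true` (kernel) and `t.ClaimFor r.curve` (the engines' value
identification), Mazur's fact and Gross–Zagier–Kolyvagin (for the central value, §1) give
`X11a.MuAnZeroAt r.curve r.p` — what part 7 took as the ASSUMED `r.MuClaim`.
[cite: MazurTateTeitelbaum1986Invent, §I.10 Prop., §I.12–I.14] [cite: Mazur1978, Cor. 4.1]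
[cite: Washington1997, §5.1 and §7.2] [cite: Miller2011LMS, §1] -/
theorem muAnZeroAt_of_record_muTable (hGZK : rank_eq_analyticRank_of_analyticRank_le_one)
    (hM : mazur_not_dvd_maninConstant_of_odd) (t : MuTable) (hc : r.check = true) (h : r.Claim)
    (hkey : t.keyOf r = true) (ht : t.checkRiemannSum = true) (hT : t.ClaimFor r.curve) :
    X11a.MuAnZeroAt r.curve r.p :=
  (classX11a_of_record_claim r hc h).muAnZeroAt_of_muTable hM
    (fun _ _ hf₀ hϖ₀ ↦ r.norm_periodRatio_mul_ratPlusSymbol_zero_le_one_of_claim hGZK hc h hf₀ hϖ₀)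
    t (p_eq_and_split_eq_of_keyOf r t hkey).1 ht
    (split_eq_true_of_claim r t h (p_eq_and_split_eq_of_keyOf r t hkey).2) hT

/-- **TABLE RECORD DOOR (crux-U currency).** For a certificate record `r` passing the recheck with its
`Claim`, a μ symbol table `t` keyed to it passing `checkRiemannSum` with its `ClaimFor r.curve`, and a
NON-surjective mod-`p` image (the image bit, displayed): `Typed.MissingUpperBoundAt r.curve r.p`, modulo
the ten facts + Greenberg–Stevens at the pair + Mazur + Gross–Zagier–Kolyvagin. The per-pair shape for
ty3's `RecordsLeafNonSurjMuTables*` / `RecordsThreeNonSurjMuTables` display files.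
[cite: Kato2004Asterisque, Thm. 12.4 (p. 221), §17.13 (pp. 279–280)] [cite: Wuthrich2014, Cor. 18 (p. 398)]
[cite: MazurTateTeitelbaum1986Invent, §I.10 Prop., §I.12–I.14] [cite: Miller2011LMS, Def. 1.1] -/
theorem missingUpperBoundAt_of_record_muTable
    (hJs : thm61_splitMultiplicative) (hJn : thm61_nonsplitMultiplicative)
    (hGZK : rank_eq_analyticRank_of_analyticRank_le_one) (hpar : nonempty_modularParametrizationData)
    (h12 : Kato2004.thm12_4)
    (hns : Kato2004.exists_multDivisibilityInputs_nonsplit)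
    (hsp : Kato2004.exists_multDivisibilityInputs_split)
    (h15 : thm15_isTorsion_multiplicative_rat)
    (h18 : Wuthrich2014.corollary18_padicLFunction_mem_iwasawaAlgebra_multiplicative)
    (hfine : Kato2004.exists_multDivisibilityInputs_fine)
    (hGS : greenberg_stevens (W := r.curve) (p := r.p))
    (hM : mazur_not_dvd_maninConstant_of_odd) (t : MuTable)
    (hc : r.check = true) (h : r.Claim) (hkey : t.keyOf r = true) (ht : t.checkRiemannSum = true)
    (hT : t.ClaimFor r.curve) (hnsj : ¬ Surj r.curve r.p) : MissingUpperBoundAt r.curve r.p :=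
  (classX11a_of_record_claim r hc h).missingUpperBoundAt_of_muAnZeroAt_of_not_surj hJs hJn hGZK hpar h12
    hns hsp h15 h18 hfine hGS hnsj (muAnZeroAt_of_record_muTable r hGZK hM t hc h hkey ht hT)

/-- **TABLE RECORD DOOR (`BSD(E,p)`) for a UNIT record** (`r.ordpShaAn = 0`, so the lower half is free,
`Record.padicValRat_shaAn_eq_zero`): `BSDp r.curve r.p` modulo the ten facts + GS + Mazur + GZK + the
image bit + the table's claim. PER PAIR (E1 currency); not a class theorem.
[cite: Miller2011LMS, §1 and Def. 1.1] [cite: Kato2004Asterisque, §17.13 (pp. 279–280)]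
[cite: Wuthrich2014, Cor. 18 (p. 398)] -/
theorem bsdp_of_record_muTable
    (hJs : thm61_splitMultiplicative) (hJn : thm61_nonsplitMultiplicative)
    (hGZK : rank_eq_analyticRank_of_analyticRank_le_one) (hpar : nonempty_modularParametrizationData)
    (h12 : Kato2004.thm12_4)
    (hns : Kato2004.exists_multDivisibilityInputs_nonsplit)
    (hsp : Kato2004.exists_multDivisibilityInputs_split)
    (h15 : thm15_isTorsion_multiplicative_rat)
    (h18 : Wuthrich2014.corollary18_padicLFunction_mem_iwasawaAlgebra_multiplicative)
    (hfine : Kato2004.exists_multDivisibilityInputs_fine)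
    (hGS : greenberg_stevens (W := r.curve) (p := r.p))
    (hM : mazur_not_dvd_maninConstant_of_odd) (t : MuTable)
    (hc : r.check = true) (h : r.Claim) (hkey : t.keyOf r = true) (ht : t.checkRiemannSum = true)
    (hT : t.ClaimFor r.curve) (hnsj : ¬ Surj r.curve r.p) (hord : r.ordpShaAn = 0) :
    BSDp r.curve r.p := by
  have hX : ClassX11a r.curve r.p := classX11a_of_record_claim r hc h
  have hμ : X11a.MuAnZeroAt r.curve r.p := muAnZeroAt_of_record_muTable r hGZK hM t hc h hkey ht hT
  obtain ⟨-, -, -, -, -, -, -, hsha, -, -⟩ := h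
  exact hX.bsdp_of_muAnZeroAt_of_not_surj_of_unit hJs hJn hGZK hpar h12 hns hsp h15 h18 hfine hGS hnsj
    hμ hsha (r.padicValRat_shaAn_eq_zero hc hord)

/-- **TABLE RECORD DOOR, NON-SPLIT variant (crux-U currency) — no Greenberg–Stevens binder**: for a
record with `r.split = false` the claim gives `¬ split` at `p` (part 6 §1c).
[cite: Kato2004Asterisque, Thm. 12.4 (p. 221), §17.13 (pp. 279–280)] [cite: Wuthrich2014, Cor. 18 (p. 398)]
[cite: MazurTateTeitelbaum1986Invent, §I.10 Prop. (a_p = −1), §I.12–I.14] [cite: Miller2011LMS, Def. 1.1] -/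
theorem missingUpperBoundAt_of_record_muTable_of_nonsplit
    (hJs : thm61_splitMultiplicative) (hJn : thm61_nonsplitMultiplicative)
    (hGZK : rank_eq_analyticRank_of_analyticRank_le_one) (hpar : nonempty_modularParametrizationData)
    (h12 : Kato2004.thm12_4)
    (hns : Kato2004.exists_multDivisibilityInputs_nonsplit)
    (hsp : Kato2004.exists_multDivisibilityInputs_split)
    (h15 : thm15_isTorsion_multiplicative_rat)
    (h18 : Wuthrich2014.corollary18_padicLFunction_mem_iwasawaAlgebra_multiplicative)
    (hfine : Kato2004.exists_multDivisibilityInputs_fine)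
    (hM : mazur_not_dvd_maninConstant_of_odd) (t : MuTable)
    (hc : r.check = true) (h : r.Claim) (hsplit : r.split = false) (hkey : t.keyOf r = true)
    (ht : t.checkRiemannSum = true) (hT : t.ClaimFor r.curve) (hnsj : ¬ Surj r.curve r.p) :
    MissingUpperBoundAt r.curve r.p := by
  have hX : ClassX11a r.curve r.p := classX11a_of_record_claim r hc h
  have hμ : X11a.MuAnZeroAt r.curve r.p := muAnZeroAt_of_record_muTable r hGZK hM t hc h hkey ht hT
  obtain ⟨-, -, -, -, -, -, hnsp, -, -, -⟩ := h
  exact hX.missingUpperBoundAt_of_muAnZeroAt_of_not_surj_of_nonsplit hJs hJn hGZK hpar h12 hns hsp h15 h18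
    hfine hnsj (hnsp hsplit) hμ

end Records

end Summit.BirchSwinnertonDyer.Rank1Residual.X11a

end
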